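import Mathlib
import HarnessLib
import HarnessLib.Audit
import Summits.KontsevichZagierPeriods.Statement
import Literature.NumberTheory.Transcendental.KZKernelConjectureForms
import Literature.NumberTheory.Transcendental.KZLogCalculusProofs
import Literature.NumberTheory.Transcendental.KZRulesAssociator
import Literature.NumberTheory.Transcendental.KZRelationsLE
import Literature.NumberTheory.Transcendental.LindemannWeierstrassProofs
import HarnessLib.Audit.Status.Attr

/-!
Route: RootDecompTorsionBridge

# Route RootDecompTorsionBridge — KZ equals monic-pi-torsion defect plus pi-primary torsion plus
pi-cancellation

It suffices to show X = TorsionDefect ∧ PiPrimaryTorsion ∧ AyoubPiCancellation (= item 0540, ↔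
KZ.PiCancellation), and X is EQUIVALENT to the summit (`summit_iff_split3`, kernel-checked
in the draft file HOME/decomp-kz-lens-5/TorsionBridge.lean, rc 0, 0 sorry): generation 2 of the
root-decomposition cell decomp-kz, lens «finite
range + asymptotic regime (known theorem) + bridging lemma», SCORING the born gen-0 route
RootDecompFiniteDefect (items 25042/25043). Work in
Kontsevich–Zagier's formal period ring P = `KZ.FormalPeriodRing` (= FormalRep ⧸ relations) with
`KZ.evalP : P →+* ℝ`, the point classes
Kpt = Subring.closure {⟦[pt, α]⟧ : α real algebraic} ≅ ℚ̄ ∩ ℝ and the disc class ϖ = ⟦π⟧ = class of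
KZ.piRep. TorsionDefect (T) = every formal
period of value 0 is killed by p(ϖ) for some MONIC p ∈ Kpt[X] (the defect is monic-ϖ-torsion).
PiPrimaryTorsion (E) = monic-ϖ-torsion is
ϖ-power torsion (×ϖ has no non-zero algebraic eigenvalue modulo ϖ^∞-torsion). PiCancellation (C₀) =
KZ.PiCancellation verbatim (shared item
stmt-KontsevichZagierPeriods-24906 / hard core 0540): ϖ is a non-zero-divisor. The seam is
bookkeeping: T gives p, E gives N, C₀ iterated N times.
ROOT DECOMPOSITION CELL decomp-kz (D-0178), GENERATION 2, node E′ = lens-5 «TorsionBridge»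
(HOME/decomp-kz-lens-5/TorsionBridge.lean v1 sha256
43508c13100cd79d7545a0ceb66e2de2112c30d5b0969d2910373dbe2bd06ab8: `summit_iff_split3` S ⟺ T ∧ E ∧
C₀, `summit_iff_sigmaSplit` / `four_cuts` (the σ-lattice), `torsionDefect_of_finiteDefect`,
`scoring` (25043 ⟹ E ∧ C₀), `discCancellation_iff_piCancellation`, the three `_of_summit` necessity
theorems; rc 0, 0 sorry, 0 warnings, std axioms), CLEARED by the critic decomp-kz-crit-1
2026-08-30T02:28:21Z «EXACT on the nose, no residual — cleanest file of the cell so far»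
(HOME/STATUS.md; HOME/CRITIC-LEDGER.md row «lens-5 gen-2 TorsionBridge v1»; probe
HOME/critic/L5g2_TorsionBridge_v1_probe.lean rc 0, std axioms): EXACT 3-piece AND-node, ONE cited
EQUIV frame (S ↔ Injective KZ.evalP) with no EQUIV beneath, NO residual. It SCORES the born gen-0
route RootDecompFiniteDefect on both sides (A 25042 ⟹ T; B 25043 ⟹ E ∧ C₀; the Cayley–Hamilton +
Lindemann seam became an edge). Typed by the cell writer decomp-kz-writer-1 as an OR-sibling (critic
w1 preference; route RootDecompFiniteDefect is NOT re-cut) with the third piece filed as item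
stmt-KontsevichZagierPeriods-0540 VERBATIM (interface typing, decl AyoubPiCancellation) so the
registered hard core is SHARED, not twinned; the glue converts it to KZ.PiCancellation inline (copy
of the → direction of the landed `BetaCancellationLine.stub_ayoubBridge`: the pinned family ([π] ×
r).reindex and one rule-(2) move per generator) and then runs the lens seam (T gives p, E gives N,
C₀ peeled N times). Native `closes` certification rc 0; BC2 C → S probes FAIL 3/3; BC7 recorded;
tribunal pre-check recorded in the writer folder. Tags: T TorsionDefect
WEAKER·IDEA-NEEDED+INSTRUMENTABLE (NEW item; ⟸ 0541, ⟸ 25042) · E PiPrimaryTorsion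
WEAKER·IDEA-NEEDED (NEW; ⟸ 0541, ⟸ 25043; multiplicative in p) · C₀ AyoubPiCancellation = 0540
SHARED hard core WEAKER·IDEA-NEEDED. Edges to post on 0541 (critic w1): 0541 ⟺ T ∧ E
(`piPowerDefect_iff` + `piPowerDefect_iff_piLocalKernel`). Writer asks carried: w2 «Kpt ≅ ℚ̄ ∩ ℝ»
ATTACKABLE support item (filed after birth if it types, else gen 3), w3 sub-rungs E₁/E₂ under E
after w2, w4 census σ-lattice EQ-family row, w5 TREE: π-adic/algebraic branch drawn as the four_cuts
chain EQ6 ⊑ E′ ⊑ E(gen 0) ⊑ SoloBlind with feeders marked. census of record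
HOME/census/COSTUME-CENSUS-v2.md sha256
f4582ebbd0eecb48bde0fc748f10348233e83bb337e1ddbe9afe10142a7be0ba (json
6b9e3db3f7361e74d20b0e90c3e285e9c58ac984be3f46f3cce64ccd758e061f; row TorsionDefect and the
σ-lattice EQ-family ask). WHY THIS IS NOVEL: the first importable, summit-level typing of the
π-torsion cut over the point classes — «the defect is monic-ϖ-torsion» ∧ «monic-ϖ-torsion is ϖ-power
torsion» ∧ π-cancellation — placed as the middle member of a PROVED lattice of exact cuts S ⟺
KernelTorsion M ∧ CancellationBy M, so that T is literally the meet of the finite-defect line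
(Cayley–Hamilton) and Ayoub's localisation line (0541), and E isolates the one kernel-side statement
of this summit with a printed why-easier (weights under the effective transfer conjecture). Rung
currency: rung 0 — nothing here proves the summit.
Lean: `TorsionDefect ∧ PiPrimaryTorsion ∧ AyoubPiCancellation`

## Assembly
Bookkeeping (no Cayley–Hamilton, no Lindemann inside `closes`): given c with eval c = 0, T gives a
monic p with p(ϖ)·⟦c⟧ = 0, E gives N with
ϖ^N·⟦c⟧ = 0, i.e. ⟦[π]^N·c⟧ = 0, and C₀ applied N times gives ⟦c⟧ = 0, i.e. c ∈ relations; the cited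
frame KontsevichZagierPeriods_iff +
kzKernelConjecture_iff_isRational + KZ.toFormalPeriod_eq_zero_iff turns this into the summit
(`closes`, all three binders consumed; no pair of
pieces closes cheaply: 7/7 must-fail probes). Conversely S ⟹ T (p = 1), S ⟹ E (Lindemann: evalP p(ϖ)
≠ 0, N = 0), S ⟹ C₀: `summit_iff_split3`.

Rationale: WHY THIS LINE. The gen-0 node FiniteDefect ∧ ElementaryCancellation (Cayley–Hamilton + Lindemann
seam) is scored on BOTH sides: FiniteDefect ⟹ T
(finite generation ⟹ torsion, `torsionDefect_of_finiteDefect`) and ElementaryCancellation ⟹ E ∧ C₀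
(`scoring`), no converse known, and the
seam becomes an edge. The cut is the middle row of a PROVED lattice (the lens's bridge made
literal): for every set M of classes of non-zero
value, S ⟺ KernelTorsion M ∧ CancellationBy M (`summit_iff_sigmaSplit`), monotone / antitone in M; M
= ϖ^ℕ is the census pair EQ6
(KZ.PiLocalKernel 0541, KZ.PiCancellation 0540), M = monic Kpt[ϖ] is this route (kernel piece T,
cancellation piece E ∧ C₀ =
MonicPiCancellation), M = ℚ̄[ϖ]^{≠0} has cancellation piece = gen-0 B, M = P^{≠0} has SoloBlind's
(C) (`four_cuts`, all identifications
kernel-checked). So T is the meeting point of the finite-range line (25042 ⟹ T) and Ayoub's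
localisation line (0541 ⟹ T), and E isolates,
importably and over Kpt, the statement (R₀) NoPiEigenvalues of the crux-idea card
lefschetz-spectrum-split (ideator 1 on 0541, 2026-08-17),
whose motivic shadow is a weight argument needing only the EFFECTIVE transfer conjecture
(HuberMullerStachPeriods2017 Thm 10.2.5,
HuberWustholz2022 Prop 7.17) — the one kernel-side statement of this summit with a printed
why-easier. Imported from: torsion theory of
modules over Kpt[X] (a PID once Kpt is identified with ℚ̄ ∩ ℝ), Cayley–Hamilton
(`LinearMap.exists_monic_and_aeval_eq_zero`), Lindemann
(`transcendental_pi_holds`, PROVED; BakerTNT1975 Thm 1.4) for admissibility of the multiplier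
system. CLEANEST DRESS OF THE NODE (lens-5 v2.5 §13 RatCoefficients, kernel-checked summit_iff_rat
in HOME/decomp-kz-lens-5/TorsionBridge.lean sha256 ac268ca2…bf0c; critic CONFIRMED
2026-08-30T03:18:53Z): the cut does not depend on the coefficient field between ℚ and ℚ̄ ∩ ℝ — S ⟺
«every kernel element of evalP is killed by a MONIC ℚ-POLYNOMIAL in [π]» (RatTorsionDefect ⟺
TorsionDefect) ∧ «the formal period ring P is TORSION-FREE as a ℚ[π]-module via [π]» (RatRegular ⟺
RatEigenCancellation ∧ DiscCancellation ⟺ RootDecompFiniteDefect.ElementaryCancellation 25043;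
RatEigenCancellation ⟺ PiPrimaryTorsion): the period conjecture ⟺ the period defect is ℚ[X]-torsion
AND P is ℚ[[π]]-torsion-free. Support item KptField (stmt-26550, provable-now) records Kpt ≅ ℚ̄ ∩ ℝ;
PiPrimaryTorsion has the finite-range dress QuadraticPiTorsion and the eigenvalue dress E₁ ∧ E₂
(evidence note on 25877).

RANKED CRUXES. #2 TorsionDefect (crux) — [ROOT-DECOMP decomp-kz gen 2 · node E′ piece T · tag WEAKER
— S ⟹ T (`torsionDefect_of_summit`); T ⟹ S NOT known; FEEDERS (kernel, lens file): item
stmt-KontsevichZagierPeriods-0541 PiLocalKernel ⟹ T (p = X^N) and gen-0 A =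
RootDecompFiniteDefect.FiniteDefect 25042 ⟹ T (Cayley–Hamilton, `torsionDefect_of_finiteDefect`) — T
is the MEET of the finite-range line and Ayoub's localisation line; verbatim the critic's
`critic_TorsionDefect` of the gen-0 probe (critic_T_def); NOT residual-shaped
(critic_T_dominates_residual: T ⟹ (MonicPiCancellation → S), converse unavailable) · NECESSARY
(binder hT: supplies the monic annihilator p) · NEW as an importable item · leaf IDEA-NEEDED +
INSTRUMENTABLE (census instrument I-A: candidate annihilators / defect-rank lower bounds in
truncations) · σ-LATTICE DOCTRINE (critic): S ⟺ KernelTorsion M ∧ CancellationBy M is exact for free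
at every admissible M (`summit_iff_sigmaSplit`, `four_cuts`: ϖ^ℕ ⊑ monic Kpt[ϖ] ⊑ ℚ̄[ϖ]^{≠0} ⊑
P^{≠0}; EQ6 = bottom member, SoloBlind (C) = top); this member is a node of record only because both
halves are WEAKER with evidence AND the cut has independent feeders (A ⟹ T, card R₀ ⟹ E) · census of
record HOME/census/COSTUME-CENSUS-v2.md sha256
f4582ebbd0eecb48bde0fc748f10348233e83bb337e1ddbe9afe10142a7be0ba (json
6b9e3db3f7361e74d20b0e90c3e285e9c58ac984be3f46f3cce64ccd758e061f; row TorsionDefect and the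
σ-lattice EQ-family ask) · verdict: critic decomp-kz-crit-1 CLEARED 2026-08-30T02:28:21Z «EXACT on
the nose, no residual — cleanest file of the cell so far» (HOME/STATUS.md; HOME/CRITIC-LEDGER.md row
«lens-5 gen-2 TorsionBridge v1»; probe HOME/critic/L5g2_TorsionBridge_v1_probe.lean rc 0, std
axioms)] the defect is monic-ϖ-torsion: every formal period x of value 0 is annihilated by p(ϖ) for
some monic polynomial p with coefficients in the point-class subring Kpt (generated by the classes
⟦[pt, α]⟧, α real algebraic), ϖ = class of KZ.piRep; equivalently (proved in the draft,
`torsionDefect_iff_locallyFiniteDefect`) every missing identity generates under multiplication by ϖ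
a finite-dimensional ℚ̄-space of missing identities. Implied by item 25042 FiniteDefect
(Cayley–Hamilton) and by item 0541 KZ.PiLocalKernel (p = X^N). [difficulty: open-problem] (why it
might fail: fails only with the summit (S ⟹ T, torsionDefect_of_summit); as a target it is
GPC-adjacent (its ℤ-form GenericPiKernel is «Kontsevich's conjecture for the localised ring»,
Ayoub2014 Cor. 32): no mechanism producing annihilators beyond dimension ≤ 1 (Baker) is known.)
[KontsevichZagier2001, Ayoub2014, HuberMullerStachPeriods2017, stmt-KontsevichZagierPeriods-0541,
stmt-KontsevichZagierPeriods-25042]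
#3 PiPrimaryTorsion (crux) — [ROOT-DECOMP decomp-kz gen 2 · node E′ piece E · tag WEAKER — S ⟹ E; E
⟹ S NOT known; implied by 0541 (`piPrimaryTorsion_of_piLocalKernel`, via Lindemann) and by gen-0 B
ElementaryCancellation 25043 (`scoring`); kernel (critic): E is MULTIPLICATIVE in p (critic_EAt_mul,
critic_EAt_X_pow) so E reduces NOW to irreducible monic factors; the remaining input for the planned
«finite range = degree ≤ 2» cut is exactly Kpt ≅ ℚ̄ ∩ ℝ (evalP injective on Subring.closure
pointClasses = KZ_le 0 in ring form) — critic w2: file it as an ATTACKABLE support item (it upgrades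
three [hand]s: the degree ≤ 2 cut, the converse B ⟸ E ∧ C₀, the Kpt-vs-ℚ coefficient equivalence
T_Kpt ⟺ T_ℚ / E_Kpt ⟺ E_ℚ via N_{K/ℚ}(p)); first honest sub-rungs (w3, after w2): E₁ (ϖ − α)·x = 0 ⟹
ϖ^N·x = 0 (α ≠ 0), E₂ ((ϖ − a)² + b²)·x = 0 ⟹ ϖ^N·x = 0 (b ≠ 0) · NOVELTY PLACEMENT (critic): the
split 0541 ⟺ T ∧ E is ideator-1's R₀ (GenericPiKernel ∧ NoPiEigenvalues, crux-idea card
lefschetz-spectrum-split on 0541, 2026-08-17) — «re-typed over Kpt» is not a delta; the deltas are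
summit-level importable typing with `closes`, the edge FiniteDefect ⟹ T, and the lattice +
monotonicity · NECESSARY (binder hE: turns p into ϖ^N) · NEW as typed · leaf IDEA-NEEDED (motivic
shadow = weight argument needing only the EFFECTIVE transfer conjecture, HuberMullerStachPeriods2017
Thm 10.2.5 / HuberWustholz2022 Prop 7.17 — the one kernel-side statement here with a printed
why-easier) · verdict: critic decomp-kz-crit-1 CLEARED 2026-08-30T02:28:21Z «EXACT on the nose, no
residual — cleanest file of the cell so far» (HOME/STATUS.md; HOME/CRITIC-LEDGER.md row «lens-5
gen-2 TorsionBridge v1»; probe HOME/critic/L5g2_TorsionBridge_v1_probe.lean rc 0, std axioms)]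
monic-ϖ-torsion is ϖ-power torsion: if p(ϖ)·x = 0 for a monic p ∈ Kpt[X] then ϖ^N·x = 0 for some N
(no non-zero algebraic eigenvalue of ×ϖ modulo ϖ^∞-torsion; the hypothesis forces evalP x = 0 by
Lindemann, so E constrains no value). Implied by 0541 (piPrimaryTorsion_of_piLocalKernel) and by
item 25043; equivalent to the Q(0) ≠ 0 form (R₀) of card lefschetz-spectrum-split by peeling
X-factors. [difficulty: XL] (why it might fail: only with the summit (S ⟹ E); as a target its
four-move proof needs the effective transfer conjecture (moves = motivic relations), unbuilt beyond
dimension 1; a class x ≠ 0 with (ϖ − α)·x = 0, α ∈ ℚ̄∖0, would refute E and S at once.)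
[HuberWustholz2022, HuberMullerStachPeriods2017, Ayoub2014, stmt-KontsevichZagierPeriods-0541]
#4 AyoubPiCancellation (crux) — [ROOT-DECOMP decomp-kz gen 2 · node E′ piece C₀ · = item
stmt-KontsevichZagierPeriods-0540 `ayoub_piCancellation` VERBATIM (interface typing: for every
pinned family P n r = [unit disc] × r, lift (of ∘ P) c ∈ relations → c ∈ relations) — SHARED
REGISTERED HARD CORE per critic w1 («C₀ = DiscCancellation ⟺ KZ.PiCancellation = 0540 PROVED
(discCancellation_iff_piCancellation) — SHARE 0540, do not twin»); the glue converts it to the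
closed-term KZ.PiCancellation INLINE (an import-free copy of the → direction of the landed
`BetaCancellationLine.stub_ayoubBridge : AyoubSpecialisation.AyoubPiCancellation ↔
KZ.PiCancellation`, Theorems/TerasomaMultiplicationBetaCancellationOfAyoubPiCancellation, PROVED;
that module is not imported because its closure (Theses.AyoubSpecialisation, TerasomaMultiplication)
is outside the farm snapshot) · tag WEAKER (stubPiCancellation_of_summit /
KZ.piCancellation_of_kernel; converse unknown) · NECESSARY (binder hC of `closes`, iterated N times)
· leaf IDEA-NEEDED (hard core; rungs: betaCancellation ↔ it, piCancellation_iff_cylinder /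
_iff_compactCylinder / _of_volumeConjectureCompact in
Theorems/AyoubSpecialisationAyoubPiCancellationCylinderForms) · edges: gen-0 B
ElementaryCancellation 25043 ⟹ E ∧ C₀ (lens `scoring`);
RootDecompRationalCubeDichotomy.PiCancellation 24906 ↔ it (same closed-term form) · verdict: critic
decomp-kz-crit-1 CLEARED 2026-08-30T02:28:21Z «EXACT on the nose, no residual — cleanest file of the
cell so far» (HOME/STATUS.md; HOME/CRITIC-LEDGER.md row «lens-5 gen-2 TorsionBridge v1»; probe
HOME/critic/L5g2_TorsionBridge_v1_probe.lean rc 0, std axioms)] π-cancellation in the filed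
signature of item 0540: for every family P pinning «unit disc in the two leading coordinates, r in
the trailing n», if the lift of c along P is a relation then c is a relation; equivalently
(stub_ayoubBridge) [π]·c ∈ relations → c ∈ relations; on P: the disc class ϖ is a non-zero-divisor.
[difficulty: open-problem] (why it might fail: a ϖ-torsion class of the naive calculus (r ≁ r' with
[π]·r ∼ [π]·r'); none known; its motivic shadow (injectivity P̃(MM^eff) → P̃(MM)) is open
(HuberWustholz2022 App. A.4); implied by the summit, so it fails only with S.)
[KontsevichZagier2001, HuberWustholz2022, Ayoub2014, stmt-KontsevichZagierPeriods-0540]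

TWO-LAYER PLAN. Foreseen glued splits (not filed now): (i) PiPrimaryTorsion ⇐ LinearEigen
(cancellation of ϖ − α modulo ϖ^∞-torsion, α real algebraic ≠ 0)
→ QuadraticEigen ((ϖ − a)² + b², b ≠ 0) → PiPrimaryTorsion, glue = factorisation of monic
polynomials over the real closed field Kpt ≅ ℚ̄ ∩ ℝ
into monic factors of degree ≤ 2 (FTA + complex conjugation) — the lens's literal finite range
«degree ≤ 2»; needs Kpt = field in P
(point-class arithmetic) first; (ii) TorsionDefect ⇐ TorsionDefect restricted to images of
FormalRep_{≤ d} as INSTRUMENT rungs (d = 1 is a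
theorem via Baker/KZ_le 1; d = 2 sits over KZDimTwo), not filed before the census reports.

KILL CRITERIA. A refutation of any piece refutes the SUMMIT (S ⟹ T, S ⟹ E, S ⟹ C₀ proved), so the
route closes refuted:<Decl> together with the problem.
Retired not-a-thesis if T ⟹ S or E ∧ C₀ ⟹ S is proved cheaply (then the cut is a costume; the
square-zero model P_num ⋉ ℚ̄ε with
(ϖ − α)ε = 0 satisfies T and violates E, so ring theory alone cannot); superseded by
RootDecompFiniteDefect only if FiniteDefect ⟸ T is
proved (not expected: T allows one annihilator per class).

NOT DECOMPOSED YET. The degree ≤ 2 split of E and of MonicPiCancellation (Two-layer plan (i)) waits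
for the Kpt-field lemma in Lean; no dimension-restricted rungs of
T are filed before the census; the lattice rows M = ℚ̄[ϖ]^{≠0} (ElementaryTorsionDefect ∧ gen-0 B)
and M = P^{≠0} (DefectZeroDivisors ∧
SoloBlind C) are recorded in the draft, not filed as items (the writer may re-cut along any row with
the same glue shape).

CHEAPEST FALSIFIER. Kernel + lookup, already run: (i) does any piece or any PAIR of pieces give S
cheaply? 7/7 must-fail probes `exact? | simpa | unfold; simpa |
aesop` fail (bc/g2/mustfail_v2.out.json); BC7 `#h21_crux_probe … summit := KontsevichZagierPeriods`
on T, E, DiscCancellation,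
MonicPiCancellation: 4/4 VERDICT CLEAN, P5 C → S not closed (bc/g2/bc7_v2.out.txt); (ii) is T ≡ 0541
or E ∧ C₀ ≡ 0540 by a cheap trick? the
groupings proved are PiPowerDefect ⟺ T ∧ E and MonicPiCancellation ⟺ E ∧ C₀, so T ≡ 0541 would need
E ⟸ T and E ∧ C₀ ≡ C₀ would need
E ⟸ C₀ — neither closes (pair probes); (iii) numerically: a product certificate p(ϖ)·x ∼ 0 with p ≠
X^N for a census class x of value 0
would exhibit an algebraic eigenvalue and refute E ∧ S.

NUMBERS. Draft file TorsionBridge.lean: 783 lines, rc 0, 0 sorry, 0 warnings, ≈ 20 s on the farm;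
axioms(closes, summit_iff_split3, four_cuts) =
propext / Classical.choice / Quot.sound; BC7 4/4 CLEAN (82 s); must-fail 7/7. Rungs in tree:
cancellation by n+1 and by non-zero algebraic
constants PROVED (units of P); by ϖ OPEN (0540); kernel side on dim ≤ 1 rational PROVED with N = 0
(Baker, ayoubPiLocalKernel_on_dim_le_one).

DEFINITION REQUESTS. None: Kpt and ϖ are spelled out with Subring.closure over existing KZ
declarations (IntegralRep.unit, constMul, piRep, toFormalPeriod, of,
evalP); Polynomial / Monic / aeval are Mathlib.

Novelty: Searches (2026-08-30): tree `rg
"KernelTorsion|CancellationBy|monicPi|TorsionDefect|NoPiEigen|GenericPiKernel"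
Summits/KontsevichZagierPeriods` (hits: only Cruxes/AyoubPiLocalKernel/IdeasSketch_r1_k1.lean +
Ideas/lefschetz-spectrum-split.md, ℤ-coefficient split of 0541, non-importable; and the gen-0
FiniteDefect files), decomp-kz census COSTUME-CENSUS-v1 rows EQ1–EQ9 / A1–A9 (only the M = ϖ^ℕ row
EQ6 and SoloBlind's cancellation half), TREE.md (no torsion-shaped node); corpus `lit search
--hybrid "torsion of the module of periods under multiplication by pi Kontsevich conjecture"` and
`lit vsearch "the kernel of the period map is torsion for multiplication by 2 pi i"` (generic hits:
HuberMullerStachPeriods2017 §13.2 localisation P^eff[1/2πi], Ayoub2014 Def. 6 / Conj. 7 — the M =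
ϖ^ℕ row only); galaxy `lit galaxy search "localized period ring|inverting 2 pi i|effective periods"
--star all` (Ayoub EMS Newsletter 91, Fresán notes — same row); no hits for "monic polynomial in pi
annihilates" / "multiplier system period conjecture" in corpus(fts+vec) and galaxy.
Nearest prior art found: Ayoub2014 Conj. 7 / HuberMullerStachPeriods2017 Prop. 13.2.6 (localisation
at 2πi = row 1); in tree AyoubSpecialisation (EQ6),
Cruxes/AyoubPiLocalKernel/Ideas/lefschetz-spectrum-split.md (GenericPiKernel ∧ NoPiEigenvalues =
0541, ℤ-coefficients), RootDecompFiniteDefect (gen 0, this lens), SoloBlindSummitSplit (cancellation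
conjunct C).
Delta: the summit cut along an ARBITRARY multiplier system with  [refs: HuberMullerStachPeriods2017, Ayoub2014]

Barriers (technique_class: commutative-algebra, torsion-theory, lindemann): - technique_class: commutative-algebra, torsion-theory, lindemann, period-ring
- Literature.Barriers.KontsevichZagierPeriods.noSemialgebraicPrimitive_inv_sub_two:
(AlgebraicPrimitivesObstruction, with algebraicPrimitivesObstructionNarrow) outside — all three
pieces live in the UNTRUNCATED quotient P = FormalRep ⧸ relations (no relationsLE / EquivalentLE),
so certificates may pass through any dimension; the obstruction quantifies over fixed-arity
primitive searches only.
- Literature.Barriers.KontsevichZagierPeriods.kzConjecture_implies_oddZetaAlgIndep: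
(GrothendieckPeriodConjectureDependence, with kzConjecture_implies_twoPiI_log_algIndep and
kzConjecture_implies_ellipticPeriods_algIndep) T carries it openly (with E ∧ C₀ it is the summit,
and its ℤ-form is Kontsevich's conjecture for the localised ring); E does NOT engage it (its
hypothesis forces value 0, its motivic shadow is a theorem by weights); C₀ = 0540 carries the
effective-vs-localised injectivity question (HuberWustholz2022 App. A.4). The bet is the lattice:
each enlargement of the multiplier system moves GPC-content from the kernel piece into a
cancellation piece that census instruments can attack certificate by certificate.
- Literature.Barriers.KontsevichZagierPeriods.cressonViuSos_prop_3_2: (HauptvermutungObstruction)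
untouched — one formalism (the KZ four-move calculus and its quotient ring) throughout.
- Literature.Barriers.KontsevichZagierPeriods.not_complete_of_undecidable:
(PeriodEqualityDecidability, with n

sub-problem: KontsevichZagierPeriods · status: draft · opened planner-decomp-kz-writer-1-g0-0 2026-08-30T02:51:58Z · rev 1 · ledger route-KontsevichZagierPeriods-RootDecompTorsionBridge
GENERATED by the gate from the ledger (D-0016/17). Provers cite these decls: `theorem foo : Summit.KontsevichZagierPeriods.KontsevichZagierPeriods.Theses.RootDecompTorsionBridge.<Decl> := …` in Summits/KontsevichZagierPeriods/KontsevichZagierPeriods/Theorems/<Name>.lean.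
-/

namespace Summit.KontsevichZagierPeriods.KontsevichZagierPeriods.Theses.RootDecompTorsionBridge

open scoped BigOperators Topology Manifold Classical MeasureTheory ProbabilityTheory Matrix InnerProductSpace ComplexConjugate ContinuousMap
open Filter Set Function TopologicalSpace MeasureTheory

attribute [summit_statement] _root_.KontsevichZagierPeriods

open Literature Periods

/-- item stmt-KontsevichZagierPeriods-25876 · crux · rank 2 · open · by planner
why it might fail: fails only with the summit (S ⟹ T, torsionDefect_of_summit); as a target it is GPC-adjacent (its ℤ-form GenericPiKernel is «Kontsevich's conjecture for the localised ring», Ayoub2014 Cor. 32): no mechanism producing annihilators beyond dimension ≤ 1 (Baker) is known.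
sources: KontsevichZagier2001, Ayoub2014, HuberMullerStachPeriods2017, stmt-KontsevichZagierPeriods-0541, stmt-KontsevichZagierPeriods-25042
[crux] [ROOT-DECOMP decomp-kz gen 2 · node E′ piece T · tag WEAKER — S ⟹ T
(`torsionDefect_of_summit`); T ⟹ S NOT known; FEEDERS (kernel, lens file): item
stmt-KontsevichZagierPeriods-0541 PiLocalKernel ⟹ T (p = X^N) and gen-0 A =
RootDecompFiniteDefect.FiniteDefect 25042 ⟹ T (Cayley–Hamilton, `torsionDefect_of_finiteDefect`) — T
is the MEET of the finite-range line and Ayoub's localisation line; verbatim the critic's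
`critic_TorsionDefect` of the gen-0 probe (critic_T_def); NOT residual-shaped
(critic_T_dominates_residual: T ⟹ (MonicPiCancellation → S), converse unavailable) · NECESSARY
(binder hT: supplies the monic annihilator p) · NEW as an importable item · leaf IDEA-NEEDED +
INSTRUMENTABLE (census instrument I-A: candidate annihilators / defect-rank lower bounds in
truncations) · σ-LATTICE DOCTRINE (critic): S ⟺ KernelTorsion M ∧ CancellationBy M is exact for free
at every admissible M (`summit_iff_sigmaSplit`, `four_cuts`: ϖ^ℕ ⊑ monic Kpt[ϖ] ⊑ ℚ̄[ϖ]^{≠0} ⊑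
P^{≠0}; EQ6 = bottom member, SoloBlind (C) = top); this member is a node of record only because both
halves are WEAKER with evidence AND the cut has independent feeders (A ⟹ T, card R₀ ⟹ E) · census of
record HOME/census/C -/
@[route_item "route-KontsevichZagierPeriods-RootDecompTorsionBridge", crux]
def TorsionDefect : Prop :=
  ∀ x : Literature.NumberTheory.Transcendental.KZ.FormalPeriodRing, Literature.NumberTheory.Transcendental.KZ.evalP x = 0 → ∃ p : Polynomial (Subring.closure {y : Literature.NumberTheory.Transcendental.KZ.FormalPeriodRing | ∃ (α : ℝ) (hα : IsAlgebraic ℚ α), y = Literature.NumberTheory.Transcendental.KZ.toFormalPeriod (Literature.NumberTheory.Transcendental.KZ.of (Literature.NumberTheory.Transcendental.KZ.IntegralRep.unit.constMul α hα))}), p.Monic ∧ Polynomial.aeval (Literature.NumberTheory.Transcendental.KZ.toFormalPeriod (Literature.NumberTheory.Transcendental.KZ.of Literature.NumberTheory.Transcendental.KZ.piRep)) p * x = 0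

/-- item stmt-KontsevichZagierPeriods-25877 · crux · rank 3 · open · by planner
why it might fail: only with the summit (S ⟹ E); as a target its four-move proof needs the effective transfer conjecture (moves = motivic relations), unbuilt beyond dimension 1; a class x ≠ 0 with (ϖ − α)·x = 0, α ∈ ℚ̄∖0, would refute E and S at once.
sources: HuberWustholz2022, HuberMullerStachPeriods2017, Ayoub2014, stmt-KontsevichZagierPeriods-0541
[crux] [ROOT-DECOMP decomp-kz gen 2 · node E′ piece E · tag WEAKER — S ⟹ E; E ⟹ S NOT known; implied
by 0541 (`piPrimaryTorsion_of_piLocalKernel`, via Lindemann) and by gen-0 B ElementaryCancellation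
25043 (`scoring`); kernel (critic): E is MULTIPLICATIVE in p (critic_EAt_mul, critic_EAt_X_pow) so E
reduces NOW to irreducible monic factors; the remaining input for the planned «finite range = degree
≤ 2» cut is exactly Kpt ≅ ℚ̄ ∩ ℝ (evalP injective on Subring.closure pointClasses = KZ_le 0 in ring
form) — critic w2: file it as an ATTACKABLE support item (it upgrades three [hand]s: the degree ≤ 2
cut, the converse B ⟸ E ∧ C₀, the Kpt-vs-ℚ coefficient equivalence T_Kpt ⟺ T_ℚ / E_Kpt ⟺ E_ℚ via
N_{K/ℚ}(p)); first honest sub-rungs (w3, after w2): E₁ (ϖ − α)·x = 0 ⟹ ϖ^N·x = 0 (α ≠ 0), E₂ ((ϖ −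
a)² + b²)·x = 0 ⟹ ϖ^N·x = 0 (b ≠ 0) · NOVELTY PLACEMENT (critic): the split 0541 ⟺ T ∧ E is
ideator-1's R₀ (GenericPiKernel ∧ NoPiEigenvalues, crux-idea card lefschetz-spectrum-split on 0541,
2026-08-17) — «re-typed over Kpt» is not a delta; the deltas are summit-level importable typing with
`closes`, the edge FiniteDefect ⟹ T, and the lattice + monotonicity · NECESSARY (binder hE: turns p
into ϖ^N) -/
@[route_item "route-KontsevichZagierPeriods-RootDecompTorsionBridge", crux]
def PiPrimaryTorsion : Prop :=
  ∀ p : Polynomial (Subring.closure {y : Literature.NumberTheory.Transcendental.KZ.FormalPeriodRing | ∃ (α : ℝ) (hα : IsAlgebraic ℚ α), y = Literature.NumberTheory.Transcendental.KZ.toFormalPeriod (Literature.NumberTheory.Transcendental.KZ.of (Literature.NumberTheory.Transcendental.KZ.IntegralRep.unit.constMul α hα))}), p.Monic → ∀ x : Literature.NumberTheory.Transcendental.KZ.FormalPeriodRing, Polynomial.aeval (Literature.NumberTheory.Transcendental.KZ.toFormalPeriod (Literature.NumberTheory.Transcendental.KZ.of Literature.NumberTheory.Transcendental.KZ.piRep))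 p * x = 0 → ∃ N : ℕ, (Literature.NumberTheory.Transcendental.KZ.toFormalPeriod (Literature.NumberTheory.Transcendental.KZ.of Literature.NumberTheory.Transcendental.KZ.piRep)) ^ N * x = 0

/-- item stmt-KontsevichZagierPeriods-0540 · crux · rank 4 · open · by planner
why it might fail: a ϖ-torsion class of the naive calculus (r ≁ r' with [π]·r ∼ [π]·r'); none known; its motivic shadow (injectivity P̃(MM^eff) → P̃(MM)) is open (HuberWustholz2022 App. A.4); implied by the summit, so it fails only with S.
sources: KontsevichZagier2001, HuberWustholz2022, Ayoub2014, stmt-KontsevichZagierPeriods-0540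
PiCancellation := ∀ c : Literature.NumberTheory.Transcendental.KZ.FormalRep, (of piRep) ⋆ c ∈
Literature.NumberTheory.Transcendental.KZ.relations → c ∈
Literature.NumberTheory.Transcendental.KZ.relations, piRep = closed unit disc with integrand 1 (d =
2). A consequence of S (eval (piRep ⋆ c) = π · eval c by Fubini, π ≠ 0), but transcendence-free: it
is a regular-element property of the presented abelian group FormalRep/relations under the product,
and the exact point where Ayoub's relative theorem fails to be effective (AyoubRelKZRevisited Rem
1.3: the torsor exists only over D((2πi)⁻¹)) and where HuberMullerStach2017 §13 passes from P^eff to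
P = P^eff[(2πi)⁻¹]. Independent of the chosen π-representation once `relations` is an ideal under ⋆
(part of the def request). Attack suggestions: (i) normal forms for ⋆-multiples of disc reps (the
disc factor occupies two leading coordinates untouched by NL along the last coordinate; CoV may mix
them — the crux is whether a relation certificate for piRep ⋆ c can be 'projected' to one for c,
e.g. by restricting/fibrewise-specialising the disc coordinates at a rational point and using domain
additivity); (ii) small cases: c supported in dimensi -/
@[route_item "route-KontsevichZagierPeriods-RootDecompTorsionBridge", crux]
def AyoubPiCancellation : Prop :=
  ∀ (P : ∀ n : ℕ, Literature.NumberTheory.Transcendental.KZ.IntegralRep n → Literature.NumberTheory.Transcendental.KZ.IntegralRep (n + 2)), (∀ (n : ℕ) (r : Literature.NumberTheory.Transcendental.KZ.IntegralRep n), (P n r).domain = {z : Fin (n + 2) → ℝ | z 0 ^ 2 + z 1 ^ 2 ≤ 1 ∧ (fun i : Fin n => z i.succ.succ) ∈ r.domain} ∧ (P n r).integrand = fun z => r.integrand (fun i : Fin n => z i.succ.succ)) → ∀ c : Literature.NumberTheory.Transcendental.KZ.FormalRep, FreeAbelianGroup.lift (fun s : (Σ n, Literature.NumberTheory.Transcendental.KZ.IntegralRep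 n) => Literature.NumberTheory.Transcendental.KZ.of (P s.1 s.2)) c ∈ Literature.NumberTheory.Transcendental.KZ.relations → c ∈ Literature.NumberTheory.Transcendental.KZ.relations

/-- item stmt-KontsevichZagierPeriods-26550 · support · rank 9 · open · by planner
[support] [ROOT-DECOMP decomp-kz gen 2 · node E′ support (critic w2/w6 of the TorsionBridge v2.4
verdict, CLEARED 2026-08-30T03:06:57Z): «Kpt ≅ ℚ̄ ∩ ℝ» in the born route vocabulary — (i) evalP is
injective on the point-class subring (KZ_le 0 in ring form), (ii) every point-class element of
non-zero value is invertible inside it (it is a FIELD), (iii) the subring closure adds nothing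
(every element is a single point class). PROVABLE-NOW: proof = theorem kptField_holds (§9:
kpt_coe_eq_zero_iff, kpt_exists_inv, exists_eq_pc_of_mem_kpt) in
HOME/decomp-kz-lens-5/TorsionBridge.lean v2.4 sha256 db647d05…8729 (rc 0, 0 sorry; attached as
evidence) — a prover ports it to Theorems/. It is a THEOREM, not a crux (critic); consequences
recorded there: PiPrimaryTorsion 25877 ⟺ QuadraticPiTorsion (only π² + cπ + d, c d point classes;
piPrimaryTorsion_iff_quadratic) ⟺ LinearPiTorsion ∧ IrredQuadraticPiTorsion
(piPrimaryTorsion_iff_eigen); S ⟺ TorsionDefect ∧ «×[π] on P has no algebraic eigenvalue»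
(summit_iff_noAlgebraicEigenvalue).] -/
@[route_item "route-KontsevichZagierPeriods-RootDecompTorsionBridge"]
def KptField : Prop :=
  (∀ k : Literature.NumberTheory.Transcendental.KZ.FormalPeriodRing, k ∈ Subring.closure {y : Literature.NumberTheory.Transcendental.KZ.FormalPeriodRing | ∃ (α : ℝ) (hα : IsAlgebraic ℚ α), y = Literature.NumberTheory.Transcendental.KZ.toFormalPeriod (Literature.NumberTheory.Transcendental.KZ.of (Literature.NumberTheory.Transcendental.KZ.IntegralRep.unit.constMul α hα))} → Literature.NumberTheory.Transcendental.KZ.evalP k = 0 → k = 0) ∧ (∀ k : Literature.NumberTheory.Transcendental.KZ.FormalPeriodRing, k ∈ Subring.closure {y : Literature.NumberTheory.Transcendental.KZ.FormalPeriodRing | ∃ (α : ℝ) (hα : IsAlgebraic ℚ α), y = Literature.NumberTheory.Transcendental.KZ.toFormalPeriod (Literature.NumberTheory.Transcendental.KZ.of (Literature.NumberTheory.Transcendental.KZ.IntegralRep.unit.constMul α hα))} → Literature.NumberTheory.Transcendental.KZ.evalP k ≠ 0 → ∃ k' : Literature.NumberTheory.Transcendental.KZ.FormalPeriodRing, k'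 ∈ Subring.closure {y : Literature.NumberTheory.Transcendental.KZ.FormalPeriodRing | ∃ (α : ℝ) (hα : IsAlgebraic ℚ α), y = Literature.NumberTheory.Transcendental.KZ.toFormalPeriod (Literature.NumberTheory.Transcendental.KZ.of (Literature.NumberTheory.Transcendental.KZ.IntegralRep.unit.constMul α hα))} ∧ k * k' = 1) ∧ (∀ k : Literature.NumberTheory.Transcendental.KZ.FormalPeriodRing, k ∈ Subring.closure {y : Literature.NumberTheory.Transcendental.KZ.FormalPeriodRing | ∃ (α : ℝ) (hα : IsAlgebraic ℚ α), y = Literature.NumberTheory.Transcendental.KZ.toFormalPeriod (Literature.NumberTheory.Transcendental.KZ.of (Literature.NumberTheory.Transcendental.KZ.IntegralRep.unit.constMul α hα))} → ∃ (α : ℝ) (hα : IsAlgebraic ℚ α), k = Literature.NumberTheory.Transcendental.KZ.toFormalPeriod (Literature.NumberTheory.Transcendental.KZ.of (Literature.NumberTheory.Transcendental.KZ.IntegralRep.unit.constMul α hα)))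

/-- item stmt-KontsevichZagierPeriods-25878 · assembly · rank 1 · open · by planner
sources: KontsevichZagier2001
[assembly] TorsionDefect → PiPrimaryTorsion → AyoubPiCancellation → the summit statement (the
deciding theorem is `closes` in glue.lean: an inline copy of stub_ayoubBridge (→) converts the 0540
form to KZ.PiCancellation, then the lens seam). -/
@[route_item "route-KontsevichZagierPeriods-RootDecompTorsionBridge"]
def Assembly : Prop :=
  TorsionDefect → PiPrimaryTorsion → AyoubPiCancellation → _root_.KontsevichZagierPeriods

/-! D-0027 §2.1 — DECIDING THEOREM (planner-authored via `route open/edit --closes-file`; by planner-decomp-kz-writer-1-g0-0 2026-08-30T02:51:58Z):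
its hypotheses are this route's items and its conclusion the sub-problem Statement (glue_lint), and it elaborates with this file. -/

-- glue.lean — deciding theorem for route RootDecompTorsionBridge (decomp-kz lens 5, generation 2; writer: third binder = item 0540 verbatim, converted inline to KZ.PiCancellation).
-- Self-contained: T gives a monic annihilator, E turns it into a power of the disc class, C₀ peels the
-- powers one at a time; the cited frame KontsevichZagierPeriods_iff + kzKernelConjecture_iff_isRational +
-- toFormalPeriod_eq_zero_iff translates `c ∈ relations` into the summit.
@[closes "route-KontsevichZagierPeriods-RootDecompTorsionBridge"] theorem closes (hT : TorsionDefect) (hE : PiPrimaryTorsion) (hC : AyoubPiCancellation) :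
    _root_.KontsevichZagierPeriods := by
  -- item 0540 (interface typing) ⟹ closed-term π-cancellation: inline copy (direction →) of the landed
  -- `BetaCancellationLine.stub_ayoubBridge` (Theorems/TerasomaMultiplicationBetaCancellationOfAyoubPiCancellation),
  -- kept import-free so the route's import closure stays inside Literature.
  have hC0 : ∀ c : Literature.NumberTheory.Transcendental.KZ.FormalRep, Literature.NumberTheory.Transcendental.KZ.of Literature.NumberTheory.Transcendental.KZ.piRep * c ∈ Literature.NumberTheory.Transcendental.KZ.relations → c ∈ Literature.NumberTheory.Transcendental.KZ.relations := by
    have h0 : ∀ n : ℕ, (finCongr (Nat.add_comm 2 n) (Fin.castAdd n (0 : Fin 2)) : Fin (n + 2)) = 0 :=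
      fun n => Fin.ext (by simp)
    have h1 : ∀ n : ℕ, (finCongr (Nat.add_comm 2 n) (Fin.castAdd n (1 : Fin 2)) : Fin (n + 2)) = 1 :=
      fun n => Fin.ext (by simp)
    have h2 : ∀ (n : ℕ) (j : Fin n),
        (finCongr (Nat.add_comm 2 n) (Fin.natAdd 2 j) : Fin (n + 2)) = j.succ.succ :=
      fun n j => Fin.ext (by simp)
    have hP : ∀ (n : ℕ) (r : Literature.NumberTheory.Transcendental.KZ.IntegralRep n),
        ((Literature.NumberTheory.Transcendental.KZ.piRep.prod r).reindex (finCongr (Nat.add_comm 2 n))).domain =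
            {z : Fin (n + 2) → ℝ | z 0 ^ 2 + z 1 ^ 2 ≤ 1 ∧ (fun i : Fin n => z i.succ.succ) ∈ r.domain} ∧
          ((Literature.NumberTheory.Transcendental.KZ.piRep.prod r).reindex (finCongr (Nat.add_comm 2 n))).integrand =
            fun z => r.integrand (fun i : Fin n => z i.succ.succ) := by
      intro n r
      refine ⟨?_, ?_⟩
      · ext z
        simp only [Literature.NumberTheory.Transcendental.KZ.IntegralRep.reindex_domain, Literature.NumberTheory.Transcendental.KZ.IntegralRep.prod_domain,
          Literature.NumberTheory.Transcendental.KZ.IntegralRep.mem_prodDomain, Literature.NumberTheory.Transcendental.KZ.piRep_domain, Literature.NumberTheory.Transcendental.KZ.mem_piDisc, Set.mem_setOf_eq, h0, h1, h2]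
      · funext z
        simp only [Literature.NumberTheory.Transcendental.KZ.IntegralRep.reindex_integrand, Literature.NumberTheory.Transcendental.KZ.IntegralRep.piRep_prod_integrand,
          Literature.NumberTheory.Transcendental.KZ.IntegralRep.prodFun, Literature.NumberTheory.Transcendental.KZ.piRep_integrand, one_mul, h2]
    have hsub : ∀ c : Literature.NumberTheory.Transcendental.KZ.FormalRep,
        Literature.NumberTheory.Transcendental.KZ.of Literature.NumberTheory.Transcendental.KZ.piRep * c -
            FreeAbelianGroup.lift (fun s : (Σ n, Literature.NumberTheory.Transcendental.KZ.IntegralRep n) =>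
              Literature.NumberTheory.Transcendental.KZ.of ((Literature.NumberTheory.Transcendental.KZ.piRep.prod s.2).reindex (finCongr (Nat.add_comm 2 s.1)))) c ∈ Literature.NumberTheory.Transcendental.KZ.relations := by
      intro c
      induction c using FreeAbelianGroup.induction_on with
      | zero => simp
      | of s =>
        obtain ⟨m, t⟩ := s
        rw [FreeAbelianGroup.lift_apply_of]
        change Literature.NumberTheory.Transcendental.KZ.of Literature.NumberTheory.Transcendental.KZ.piRep * Literature.NumberTheory.Transcendental.KZ.of t -
            Literature.NumberTheory.Transcendental.KZ.of ((Literature.NumberTheory.Transcendental.KZ.piRep.prod t).reindex (finCongr (Nat.add_comm 2 m))) ∈ Literature.NumberTheory.Transcendental.KZ.relations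
        rw [Literature.NumberTheory.Transcendental.KZ.of_mul_of]
        exact Literature.NumberTheory.Transcendental.KZ.of_sub_of_reindex_mem_relations _ _
      | neg s ih =>
        rw [mul_neg, map_neg, ← neg_sub']
        exact Literature.NumberTheory.Transcendental.KZ.relations.neg_mem ih
      | add x y hx hy =>
        rw [mul_add, map_add]
        have e : Literature.NumberTheory.Transcendental.KZ.of Literature.NumberTheory.Transcendental.KZ.piRep * x + Literature.NumberTheory.Transcendental.KZ.of Literature.NumberTheory.Transcendental.KZ.piRep * y -
            (FreeAbelianGroup.lift (fun s : (Σ n, Literature.NumberTheory.Transcendental.KZ.IntegralRep n) =>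
                Literature.NumberTheory.Transcendental.KZ.of ((Literature.NumberTheory.Transcendental.KZ.piRep.prod s.2).reindex (finCongr (Nat.add_comm 2 s.1)))) x +
              FreeAbelianGroup.lift (fun s : (Σ n, Literature.NumberTheory.Transcendental.KZ.IntegralRep n) =>
                Literature.NumberTheory.Transcendental.KZ.of ((Literature.NumberTheory.Transcendental.KZ.piRep.prod s.2).reindex (finCongr (Nat.add_comm 2 s.1)))) y) =
            (Literature.NumberTheory.Transcendental.KZ.of Literature.NumberTheory.Transcendental.KZ.piRep * x -
                FreeAbelianGroup.lift (fun s : (Σ n, Literature.NumberTheory.Transcendental.KZ.IntegralRep n) =>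
                  Literature.NumberTheory.Transcendental.KZ.of ((Literature.NumberTheory.Transcendental.KZ.piRep.prod s.2).reindex (finCongr (Nat.add_comm 2 s.1)))) x) +
              (Literature.NumberTheory.Transcendental.KZ.of Literature.NumberTheory.Transcendental.KZ.piRep * y -
                FreeAbelianGroup.lift (fun s : (Σ n, Literature.NumberTheory.Transcendental.KZ.IntegralRep n) =>
                  Literature.NumberTheory.Transcendental.KZ.of ((Literature.NumberTheory.Transcendental.KZ.piRep.prod s.2).reindex (finCongr (Nat.add_comm 2 s.1)))) y) := by
          abel
        rw [e]
        exact Literature.NumberTheory.Transcendental.KZ.relations.add_mem hx hy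
    intro c hc
    have h' := Literature.NumberTheory.Transcendental.KZ.relations.sub_mem hc (hsub c)
    rw [sub_sub_cancel] at h'
    exact hC (fun n r => (Literature.NumberTheory.Transcendental.KZ.piRep.prod r).reindex (finCongr (Nat.add_comm 2 n))) hP c h'
  have key : ∀ (n : ℕ) (d : Literature.NumberTheory.Transcendental.KZ.FormalRep),
      (Literature.NumberTheory.Transcendental.KZ.toFormalPeriod (Literature.NumberTheory.Transcendental.KZ.of Literature.NumberTheory.Transcendental.KZ.piRep)) ^ n * Literature.NumberTheory.Transcendental.KZ.toFormalPeriod d = 0 →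
        d ∈ Literature.NumberTheory.Transcendental.KZ.relations := by
    intro n
    induction n with
    | zero =>
      intro d hd
      rw [pow_zero, one_mul] at hd
      exact Literature.NumberTheory.Transcendental.KZ.toFormalPeriod_eq_zero_iff.mp hd
    | succ n ih =>
      intro d hd
      apply hC0
      apply ih
      rw [map_mul, ← mul_assoc, ← pow_succ]
      exact hd
  rw [KontsevichZagierPeriods_iff,
    ← Literature.NumberTheory.Transcendental.kzKernelConjecture_iff_isRational]
  intro c hc
  have hx : Literature.NumberTheory.Transcendental.KZ.evalP
      (Literature.NumberTheory.Transcendental.KZ.toFormalPeriod c) = 0 := by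
    rw [Literature.NumberTheory.Transcendental.KZ.evalP_toFormalPeriod]
    exact hc
  obtain ⟨p, hp, hpx⟩ := hT _ hx
  obtain ⟨N, hN⟩ := hE p hp _ hpx
  exact key N c hN

end Summit.KontsevichZagierPeriods.KontsevichZagierPeriods.Theses.RootDecompTorsionBridge
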